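import Mathlib
import Literature.Probability.Process.RootedHardCoreConfig

/-!
# `AtomicLawChargesCrystal` (stmt-AtomisticToContinuum-15778), line `Sketch`: stub `stub_stabiliserBound`

AFFINE FRAMES IN PATCHES; STABILISERS ARE UNIFORMLY FINITE. Let `D ⊆ ℝ³` be a Delone set
(`Delone.DeloneSet`, packing radius `r_p > 0`, covering radius `R_c > 0`).

(i) If an affine isometry `g` of `ℝ³` fixes every point of the patch `D ∩ B̄(x, 20 R_c)` (`x ∈ D`),
then `g = 1`. Proof: `g x = x`; for each coordinate direction `eᵢ` the covering radius gives
`pᵢ ∈ D` within `R_c` of `x + 10 R_c eᵢ`, so `dist pᵢ x ≤ 11 R_c` and `g pᵢ = pᵢ`; hence the linear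
part `L` of `g` fixes `vᵢ := pᵢ - x = 10 R_c eᵢ + εᵢ` with `‖εᵢ‖ ≤ R_c`. For any `w`, `d := L w - w`
is orthogonal to every `vᵢ` (`⟪L w, vᵢ⟫ = ⟪L w, L vᵢ⟫ = ⟪w, vᵢ⟫`), so
`10 R_c |dᵢ| = |⟪d, εᵢ⟫| ≤ R_c ‖d‖`, i.e. `100 dᵢ² ≤ ‖d‖²`; summing, `‖d‖² ≤ (3/100) ‖d‖²`, so
`d = 0`: `L = 1` and `g y = L (y - x) + g x = y`.

(ii) For every Delone `D` there is `N : ℕ` with `#{g ∈ Sym D | g x = x} ≤ N` for all `x ∈ D`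
(`Set.encard`, so stabilisers are in particular finite). Proof: the uniform packing bound
(`LocalConfig.exists_forall_encard_inter_le`, applied to the translate `D - x` and the compact ball
`B̄(0, 20 R_c)`) gives `C` with `#F ≤ C` for the patch `F := D ∩ B̄(x, 20 R_c)`, uniformly in
`x ∈ D`. A stabiliser element maps `F` to `F` (it preserves `D` and distances to `x`), and by (i)
it is determined by its restriction to `F`; so the stabiliser injects into `F → F`, of cardinality
`(#F)^(#F) ≤ C ^ C =: N`. [folklore]
-/

noncomputable section

namespace Summit.AtomisticToContinuum.Crystallization.Theorems.IsometryAtomsAtomicLawChargesCrystal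

open Metric

/-- **Approximate frames are non-degenerate.** If `R > 0`, `‖vᵢ - 10 R eᵢ‖ ≤ R` for the three
coordinate vectors `eᵢ` of `ℝ³`, and `d ⊥ vᵢ` for `i = 0, 1, 2`, then `d = 0`:
`10 R |dᵢ| = |⟪d, 10 R eᵢ⟫| = |⟪d, vᵢ - 10 R eᵢ⟫| ≤ R ‖d‖`, so `100 dᵢ² ≤ ‖d‖²` and
`‖d‖² = ∑ dᵢ² ≤ (3/100) ‖d‖²`. [folklore] -/
theorem sb_eq_zero_of_inner_frame {R : ℝ} (hR : 0 < R) {d : EuclideanSpace ℝ (Fin 3)}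
    {v : Fin 3 → EuclideanSpace ℝ (Fin 3)}
    (hv : ∀ i, ‖v i - EuclideanSpace.single i (10 * R)‖ ≤ R)
    (hd : ∀ i, inner ℝ d (v i) = 0) : d = 0 := by
  have hcoord : ∀ i, 10 * |d i| ≤ ‖d‖ := by
    intro i
    have h1 : inner ℝ d (EuclideanSpace.single i (10 * R)) = 10 * R * d i := by
      rw [EuclideanSpace.inner_single_right]
      simp
    have h2 : inner ℝ d (EuclideanSpace.single i (10 * R)) =
        -inner ℝ d (v i - EuclideanSpace.single i (10 * R)) := by
      rw [inner_sub_right, hd i, zero_sub, neg_neg]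
    have h3 : |inner ℝ d (v i - EuclideanSpace.single i (10 * R))| ≤ ‖d‖ * R :=
      (abs_real_inner_le_norm _ _).trans (mul_le_mul_of_nonneg_left (hv i) (norm_nonneg _))
    have h4 : 10 * R * |d i| ≤ ‖d‖ * R := by
      have h5 : |10 * R * d i| ≤ ‖d‖ * R := by
        rw [← h1, h2, abs_neg]
        exact h3
      rwa [abs_mul, abs_of_pos (by positivity : (0 : ℝ) < 10 * R)] at h5
    nlinarith [abs_nonneg (d i)]
  have hsq : ‖d‖ ^ 2 = d 0 ^ 2 + d 1 ^ 2 + d 2 ^ 2 := by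
    rw [EuclideanSpace.real_norm_sq_eq, Fin.sum_univ_three]
  have key : ∀ i, 100 * d i ^ 2 ≤ ‖d‖ ^ 2 := fun i => by
    nlinarith [hcoord i, abs_nonneg (d i), sq_abs (d i), norm_nonneg d]
  have hle : ‖d‖ ^ 2 ≤ 0 := by linarith [key 0, key 1, key 2]
  have hn : ‖d‖ = 0 := by nlinarith [norm_nonneg d]
  exact norm_eq_zero.1 hn

/-- **Part (i): an affine isometry fixing the patch `D ∩ B̄(x, 20 R_c)` pointwise is the identity.**
The patch contains `x` and, for each coordinate direction, a point `pᵢ` within `R_c` of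
`x + 10 R_c eᵢ` (covering radius); the linear part of `g` fixes the approximate frame `pᵢ - x`,
hence (by `sb_eq_zero_of_inner_frame` applied to `L w - w ⊥ pᵢ - x`) fixes every vector, and `g`
fixes `x`. [folklore] -/
theorem sb_eq_self_of_fix_patch (D : Delone.DeloneSet (EuclideanSpace ℝ (Fin 3)))
    (g : EuclideanSpace ℝ (Fin 3) ≃ᵃⁱ[ℝ] EuclideanSpace ℝ (Fin 3)) {x : EuclideanSpace ℝ (Fin 3)}
    (hx : x ∈ (D : Set (EuclideanSpace ℝ (Fin 3))))
    (hfix : ∀ p ∈ (D : Set (EuclideanSpace ℝ (Fin 3))),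
      dist p x ≤ 20 * (D.coveringRadius : ℝ) → g p = p)
    (y : EuclideanSpace ℝ (Fin 3)) : g y = y := by
  have hR : (0 : ℝ) < D.coveringRadius := NNReal.coe_pos.2 D.coveringRadius_pos
  have hgx : g x = x := hfix x hx (by rw [dist_self]; positivity)
  have hframe : ∀ i : Fin 3, ∃ p ∈ (D : Set (EuclideanSpace ℝ (Fin 3))),
      dist (x + EuclideanSpace.single i (10 * (D.coveringRadius : ℝ))) p ≤ D.coveringRadius :=
    fun i => D.exists_dist_le_coveringRadius _
  choose p hpD hpdist using hframe
  -- the frame points lie in the patch, hence are fixed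
  have hpfix : ∀ i, g (p i) = p i := by
    intro i
    refine hfix (p i) (hpD i) ?_
    have h1 : dist (p i) (x + EuclideanSpace.single i (10 * (D.coveringRadius : ℝ))) ≤
        D.coveringRadius := by
      rw [dist_comm]
      exact hpdist i
    have h2 : dist (x + EuclideanSpace.single i (10 * (D.coveringRadius : ℝ))) x =
        10 * D.coveringRadius := by
      rw [dist_eq_norm, add_sub_cancel_left, PiLp.norm_single, Real.norm_eq_abs,
        abs_of_pos (by positivity)]
    linarith [dist_triangle (p i) (x + EuclideanSpace.single i (10 * (D.coveringRadius : ℝ))) x]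
  -- the linear part fixes the approximate frame `p i - x`
  have hLv : ∀ i, g.linearIsometryEquiv (p i - x) = p i - x := by
    intro i
    have h := g.map_vsub (p i) x
    rwa [vsub_eq_sub, vsub_eq_sub, hpfix i, hgx] at h
  have hvn : ∀ i, ‖(p i - x) - EuclideanSpace.single i (10 * (D.coveringRadius : ℝ))‖ ≤
      D.coveringRadius := by
    intro i
    have h := hpdist i
    rwa [dist_comm, dist_eq_norm, sub_add_eq_sub_sub] at h
  -- hence the linear part is the identity
  have hLw : ∀ w, g.linearIsometryEquiv w = w := by
    intro w
    refine sub_eq_zero.1 (sb_eq_zero_of_inner_frame hR hvn fun i => ?_)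
    have h1 : inner ℝ (g.linearIsometryEquiv w) (p i - x) = inner ℝ w (p i - x) := by
      conv_lhs => rw [← hLv i]
      exact g.linearIsometryEquiv.inner_map_map w (p i - x)
    rw [inner_sub_left, h1, sub_self]
  calc g y = g ((y - x) +ᵥ x) := by rw [vadd_eq_add, sub_add_cancel]
    _ = y := by rw [g.map_vadd, hLw, hgx, vadd_eq_add, sub_add_cancel]

/-- Two affine isometries that agree on the patch `D ∩ B̄(x, 20 R_c)` (`x ∈ D`) of a Delone set `D`
are equal: `g'` followed by `g⁻¹` fixes the patch pointwise, so it is the identity by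
`sb_eq_self_of_fix_patch`. [folklore] -/
theorem sb_eq_of_eqOn_patch (D : Delone.DeloneSet (EuclideanSpace ℝ (Fin 3)))
    {g g' : EuclideanSpace ℝ (Fin 3) ≃ᵃⁱ[ℝ] EuclideanSpace ℝ (Fin 3)}
    {x : EuclideanSpace ℝ (Fin 3)} (hx : x ∈ (D : Set (EuclideanSpace ℝ (Fin 3))))
    (h : ∀ p ∈ (D : Set (EuclideanSpace ℝ (Fin 3))),
      dist p x ≤ 20 * (D.coveringRadius : ℝ) → g p = g' p) : g = g' := by
  have hid := sb_eq_self_of_fix_patch D (g'.trans g.symm) hx (fun q hqD hqx => by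
    rw [AffineIsometryEquiv.coe_trans, Function.comp_apply, ← h q hqD hqx, g.symm_apply_apply])
  refine AffineIsometryEquiv.ext fun y => ?_
  have hy := hid y
  rw [AffineIsometryEquiv.coe_trans, Function.comp_apply] at hy
  calc g y = g (g.symm (g' y)) := by rw [hy]
    _ = g' y := g.apply_symm_apply _

/-- **The stabiliser of `x ∈ D` in `Sym D` injects into the self-maps of the patch.** If `F` is the
(finite) patch `D ∩ B̄(x, 20 R_c)`, then `#{g | g '' D = D ∧ g x = x} ≤ (#F)^(#F)`: a stabiliser
element maps `F` into `F` (it preserves `D` and the distances to its fixed point `x`), and it is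
determined by this restriction (`sb_eq_of_eqOn_patch`). [folklore] -/
theorem sb_encard_stabiliser_le_pow (D : Delone.DeloneSet (EuclideanSpace ℝ (Fin 3)))
    {x : EuclideanSpace ℝ (Fin 3)} (hx : x ∈ (D : Set (EuclideanSpace ℝ (Fin 3))))
    {F : Set (EuclideanSpace ℝ (Fin 3))} (hF : F.Finite)
    (hFiff : ∀ p, p ∈ F ↔ p ∈ (D : Set (EuclideanSpace ℝ (Fin 3))) ∧
      dist p x ≤ 20 * (D.coveringRadius : ℝ)) :
    {g : EuclideanSpace ℝ (Fin 3) ≃ᵃⁱ[ℝ] EuclideanSpace ℝ (Fin 3) |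
        g '' (D : Set (EuclideanSpace ℝ (Fin 3))) = (D : Set (EuclideanSpace ℝ (Fin 3))) ∧
          g x = x}.encard ≤ ((Nat.card F ^ Nat.card F : ℕ) : ℕ∞) := by
  set S : Set (EuclideanSpace ℝ (Fin 3) ≃ᵃⁱ[ℝ] EuclideanSpace ℝ (Fin 3)) :=
    {g | g '' (D : Set (EuclideanSpace ℝ (Fin 3))) = (D : Set (EuclideanSpace ℝ (Fin 3))) ∧
      g x = x} with hS
  have hmaps : ∀ g ∈ S, ∀ p ∈ F, g p ∈ F := by
    rintro g ⟨hgD, hgx⟩ p hp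
    obtain ⟨hpD, hpx⟩ := (hFiff p).1 hp
    refine (hFiff _).2 ⟨?_, ?_⟩
    · rw [← hgD]
      exact Set.mem_image_of_mem _ hpD
    · rwa [← hgx, g.dist_map]
  haveI : Finite F := hF.to_subtype
  let Ψ : S → F → F := fun g q => ⟨(g : EuclideanSpace ℝ (Fin 3) ≃ᵃⁱ[ℝ] EuclideanSpace ℝ (Fin 3)) q,
    hmaps g g.2 q q.2⟩
  have hΨ : Function.Injective Ψ := by
    rintro ⟨g, hg⟩ ⟨g', hg'⟩ hgg'
    refine Subtype.ext (sb_eq_of_eqOn_patch D hx fun q hqD hqx => ?_)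
    exact congrArg (fun φ : F → F => (φ ⟨q, (hFiff q).2 ⟨hqD, hqx⟩⟩ : EuclideanSpace ℝ (Fin 3)))
      hgg'
  haveI : Finite S := Finite.of_injective Ψ hΨ
  have hcard : Nat.card S ≤ Nat.card F ^ Nat.card F := by
    rw [← Nat.card_fun]
    exact Nat.card_le_card_of_injective Ψ hΨ
  calc S.encard = (Nat.card S : ℕ∞) := by
        rw [← ENat.card_coe_set_eq, ENat.card_eq_coe_natCard]
    _ ≤ ((Nat.card F ^ Nat.card F : ℕ) : ℕ∞) := by exact_mod_cast hcard

/-- **Part (ii): point stabilisers in `Sym D` have uniformly bounded cardinality.** With `C` the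
uniform packing bound for `r_p`-separated sets in `B̄(0, 20 R_c)`
(`LocalConfig.exists_forall_encard_inter_le`), every patch `D ∩ B̄(x, 20 R_c)` (`x ∈ D`) has at
most `C` points (translate by `-x`), so by `sb_encard_stabiliser_le_pow` every stabiliser has at
most `C ^ C` elements. [folklore] -/
theorem sb_exists_encard_stabiliser_le (D : Delone.DeloneSet (EuclideanSpace ℝ (Fin 3))) :
    ∃ N : ℕ, ∀ x ∈ (D : Set (EuclideanSpace ℝ (Fin 3))),
      {g : EuclideanSpace ℝ (Fin 3) ≃ᵃⁱ[ℝ] EuclideanSpace ℝ (Fin 3) |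
        g '' (D : Set (EuclideanSpace ℝ (Fin 3))) = (D : Set (EuclideanSpace ℝ (Fin 3))) ∧
          g x = x}.encard ≤ N := by
  have hδ : (0 : ℝ) < D.packingRadius := NNReal.coe_pos.2 D.packingRadius_pos
  obtain ⟨C, hC⟩ := Literature.Probability.Process.LocalConfig.exists_forall_encard_inter_le hδ
    (isCompact_closedBall (0 : EuclideanSpace ℝ (Fin 3)) (20 * (D.coveringRadius : ℝ)))
  refine ⟨C ^ C, fun x hx => ?_⟩
  -- the patch around `x` and its uniform cardinality bound
  set F : Set (EuclideanSpace ℝ (Fin 3)) :=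
    {p | p ∈ (D : Set (EuclideanSpace ℝ (Fin 3))) ∧ dist p x ≤ 20 * (D.coveringRadius : ℝ)}
    with hFdef
  have hFC : F.encard ≤ C := by
    have hsep : ∀ a ∈ (fun p => p - x) '' (D : Set (EuclideanSpace ℝ (Fin 3))),
        ∀ b ∈ (fun p => p - x) '' (D : Set (EuclideanSpace ℝ (Fin 3))), a ≠ b →
          (D.packingRadius : ℝ) ≤ dist a b := by
      rintro _ ⟨a, ha, rfl⟩ _ ⟨b, hb, rfl⟩ hab
      rw [dist_sub_right]
      exact (D.packingRadius_lt_dist_of_mem_ne ha hb fun h => hab (by rw [h])).le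
    have hsub : (fun p => p - x) '' F ⊆
        closedBall 0 (20 * (D.coveringRadius : ℝ)) ∩
          (fun p => p - x) '' (D : Set (EuclideanSpace ℝ (Fin 3))) := by
      rintro _ ⟨a, ⟨haD, hax⟩, rfl⟩
      exact ⟨by rwa [mem_closedBall, dist_zero_right, ← dist_eq_norm], a, haD, rfl⟩
    calc F.encard = ((fun p => p - x) '' F).encard := (sub_left_injective.encard_image F).symm
      _ ≤ _ := Set.encard_le_encard hsub
      _ ≤ C := hC _ hsep
  have hFfin : F.Finite := Set.finite_of_encard_le_coe hFC
  have hxF : x ∈ F := ⟨hx, by rw [dist_self]; positivity⟩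
  haveI : Finite F := hFfin.to_subtype
  have hFle : Nat.card F ≤ C := by
    rw [Nat.card_coe_set_eq]
    exact_mod_cast hFfin.cast_ncard_eq.trans_le hFC
  have hFpos : 0 < Nat.card F := Nat.card_pos_iff.2 ⟨⟨⟨x, hxF⟩⟩, inferInstance⟩
  have hCpos : 0 < C := hFpos.trans_le hFle
  have hpow : Nat.card F ^ Nat.card F ≤ C ^ C :=
    (Nat.pow_le_pow_left hFle _).trans (Nat.pow_le_pow_right hCpos hFle)
  calc _ ≤ ((Nat.card F ^ Nat.card F : ℕ) : ℕ∞) :=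
        sb_encard_stabiliser_le_pow D hx hFfin (fun p => by rw [hFdef]; rfl)
    _ ≤ ((C ^ C : ℕ) : ℕ∞) := by exact_mod_cast hpow

/-- **SB — AFFINE FRAMES IN PATCHES; STABILISERS ARE UNIFORMLY FINITE** (registered stub of line
`Sketch`). (i) An affine isometry of `ℝ³` fixing pointwise the patch `D ∩ B̄(x, 20 R_c)` (`x ∈ D`,
`R_c` the covering radius) of a Delone set `D` is the identity (`sb_eq_self_of_fix_patch`);
(ii) for every Delone `D` there is `N : ℕ` with `#{g | g '' D = D ∧ g x = x} ≤ N` for all `x ∈ D`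
(`sb_exists_encard_stabiliser_le`). [folklore] -/
theorem stub_stabiliserBound :
    (∀ (D : Delone.DeloneSet (EuclideanSpace ℝ (Fin 3))) (g : EuclideanSpace ℝ (Fin 3) ≃ᵃⁱ[ℝ] EuclideanSpace ℝ (Fin 3)), ∀ x ∈ (D : Set (EuclideanSpace ℝ (Fin 3))), (∀ p ∈ (D : Set (EuclideanSpace ℝ (Fin 3))), dist p x ≤ 20 * (D.coveringRadius : ℝ) → g p = p) → ∀ y : EuclideanSpace ℝ (Fin 3), g y = y) ∧
    (∀ D : Delone.DeloneSet (EuclideanSpace ℝ (Fin 3)), ∃ N : ℕ, ∀ x ∈ (D : Set (EuclideanSpace ℝ (Fin 3))), {g : EuclideanSpace ℝ (Fin 3) ≃ᵃⁱ[ℝ] EuclideanSpace ℝ (Fin 3) | g '' (D : Set (EuclideanSpace ℝ (Fin 3))) = (D : Set (EuclideanSpace ℝ (Fin 3))) ∧ g x = x}.encard ≤ N) :=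
  ⟨fun D g _ hx hfix y => sb_eq_self_of_fix_patch D g hx hfix y, sb_exists_encard_stabiliser_le⟩

end Summit.AtomisticToContinuum.Crystallization.Theorems.IsometryAtomsAtomicLawChargesCrystal
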